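import Literature.Computability.AlgebraicComplexity.DDS21DeborderPiSigmaProofs
import Literature.Computability.AlgebraicComplexity.DDS21PiSigmaClosedProofs
import Literature.Computability.AlgebraicComplexity.DDS21DepthThreeDiagonalToolkit
import HarnessLib

/-!
# Dutta–Dwivedi–Saxena 2021, Lemma 2.20: de-bordering a bloated product-ratio class (proofs)

Topic `Literature/Computability/AlgebraicComplexity`; a PROOFS file (D-0014): theorems only, no
definitions, no named facts (cell `val-lit`, row X2-DDS21, brick "B0-ext" of the
`DDS2021_thm_3_2` / `DDS2021_thm_5_1` programme). Source: P. Dutta, P. Dwivedi, N. Saxena,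
*Demystifying the border of depth-3 algebraic circuits*, FOCS 2021 [DuttaDwivediSaxena2022],
held full version `paper:galaxy-pdf-7641649743695546420` (chunk `pNNNN.txt`, printed line `Lnnn`).

## What is proved (the `ε → 0` layer of the DiDIL argument)

Throughout `K = F(ε) = RatFunc F`, `A = F[ε] = F[X]`, `ι = algebraMap F[X] (RatFunc F)` and the
reduction `ε ↦ 0` is `Polynomial.constantCoeff : F[X] →+* F`, both acting coefficientwise on
multivariate polynomials through `MvPolynomial.map`.

* **`ε`-adic normal form** (`exists_epsNormalForm`): every nonzero `g ∈ K[x]` is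
  `g = C c * map ι G` with `c ∈ K^×`, `G ∈ A[x]` and `G(ε = 0) ≠ 0` — DDS's standing device
  "`T =: ε^{a} · T̃`, `T̃ = t + ε·t̃`, `t = T̃|_{ε=0} ≠ 0`" (§2 "Valuation" p0015 L407–410; §3 p0027
  L729–733, p0028 L760), for POLYNOMIALS (the scalar case is the tree's
  `DDS2021.exists_normalize_family`).
* **The approximation predicate, unfolded** (`isEpsApprox_iff_exists_map`, `mem_border_iff`):
  `MS2021.IsEpsApprox f g` (same number of variables) iff `g = map ι G` for some `G ∈ A[x]` with
  `G(ε = 0) = f` (Def. 2.1, p0016 L416–419: "`g(x,ε) := f(x) + ε·Q(x,ε)`").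
* **Limit of a proportionality** (`exists_ord_of_C_mul_map_eq_map`, `exists_limit_ratio`): if
  `C c * map ι N = map ι M` with `N(0) ≠ 0`, then `ord_ε c ≥ 0`, i.e. `c · ι Q = ι (ε^a P)` with
  `P(0) Q(0) ≠ 0`, and `ε^a P · N = Q · M` over `A`; hence `M(0) = u · N(0)` for a scalar `u ∈ F`
  which is nonzero exactly when `M(0) ≠ 0` ("Since the left side … is well-defined at `ε = 0`, it
  must happen that `… ≥ 0`. If `… ≥ 1`, then `f = 0`", p0027 L733–735).
* **Lemma 2.20** (`border_mulDiv`, p0023 L628–636): "`\overline{(𝒞/𝒞)·(𝒟/𝒟)} ⊆ (𝒞̄/𝒞̄)·(𝒟̄/𝒟̄)`"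
  for classes `𝒞, 𝒟` of polynomials over `K` closed under nonzero `K`-scalars, in
  POLYNOMIAL-CLEARED form: if `g₁ h₁ · ι E = ι M · g₂ h₂` with `gᵢ ∈ 𝒞`, `hᵢ ∈ 𝒟`, `g₂ h₂ ≠ 0`,
  `E(0) ≠ 0` (so the ratio `(g₁/g₂)(h₁/h₂)` equals the `ε`-integral fraction `M/E`), then
  `M(0) · Ĝ₂ Ĥ₂ = u · Ĝ₁ Ĥ₁ · E(0)` with `Ĝᵢ ∈ 𝒞̄ = border 𝒞`, `Ĥᵢ ∈ border 𝒟`, `Ĝ₂ Ĥ₂ ≠ 0`;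
  the printed target "`f + ε·Q`, `f ∈ F(x)`" is the instance `E = f₂ · D`, `M = f₁ · D + ε · S · f₂`
  (`border_mulDiv_ratio`).
* **Claim 3.3, the `ε`-side** (`deborder_gen_one`, p0027 L724–744): for DDS's bloated class
  `Gen(1,·) = (ΠΣ/ΠΣ)·(Σ∧Σ/Σ∧Σ)` (Def. 3.1, p0026 L702–707) this gives
  "`f = (lim Ũ / lim Ṽ) · (lim P̃ / lim Q̃) ∈ (ΠΣ/ΠΣ) · (\overline{Σ∧Σ}/\overline{Σ∧Σ})`" on the
  tree's normal forms `DDS2021.spsClass K n 1 d` (`ΠΣ`) and `DDS2021.swsClass K n t e` (`Σ∧Σ`),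
  using `\overline{ΠΣ} = ΠΣ` by name (`isSPS_one_of_isEpsApprox`,
  `DDS21DeborderPiSigmaProofs.lean`). The subsequent "`⊆ ABP/ABP`" conversion is NOT restated here:
  it is the business of the ABP toolkit (`UABPToolkit.lean`: `uabpComputes_of_mem_spsClass`) and of
  the read-once de-bordering file (`DDS21DeborderReadOnce.lean`, Lemma 2.23).
* **`lim_{ε→0}` is a congruence** (`MS2021.IsEpsApprox.add/mul/neg/sub/pow/unique/rename/bind₁/pderiv`,
  `isEpsApprox_sum/prod/C/X/zero`, `IsEpsApprox.add_eps_mul`): the approximation predicate commutes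
  with the ring operations, with substitutions of approximated polynomials — in particular with
  substitutions defined over `F` such as DDS's `Φ : x_i ↦ z·x_i + α_i` ("`Φ(g₀) = Φ(f₀) + ε·Φ(S₀)`",
  p0028 L751–757) — and with partial derivatives (the DERIVE step, p0029 L766–785), and the limit
  is unique.
* **The single-ratio case** `\overline{𝒞/𝒞} ⊆ \overline{𝒞}/\overline{𝒞}` (`border_div`,
  `border_div_ratio`) and its `Σ∧Σ` instance `border_div_swsClass` = the limit step of Claim 3.8
  ("`lim_{ε→0}(Σ∧Σ/Σ∧Σ) ⊆ (\overline{Σ∧Σ}/\overline{Σ∧Σ}) ⊆ ARO/ARO`", p0036 L938–943), the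
  `Σ∧Σ` scalar closure being `C_mul_mem_swsClass` of `DDS21DepthThreeDiagonalToolkit.lean`.

Honest framing: elementary `ε`-adic (Gauss-lemma) bookkeeping; nothing here bears on VP versus VNP,
which is NOT proved; `DDS2021_thm_3_2` and `DDS2021_thm_5_1` remain named facts. The `z`-adic
("`mod z^{d_j}`") bookkeeping of DDS §3 (Claims 3.4–3.8) is not addressed in this file.

## References

* [DuttaDwivediSaxena2022] P. Dutta, P. Dwivedi, N. Saxena, *Demystifying the border of depth-3
  algebraic circuits*, Proc. 62nd FOCS (2021), IEEE 2022, 92–103; full version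
  `paper:galaxy-pdf-7641649743695546420`: §2 "Valuation" p0015 L407–410, Def. 2.1 p0016 L416–419,
  Lemma 2.19 p0023 L612–620, Lemma 2.20 p0023 L628–636 (proof p0023–p0024), Def. 3.1 p0026
  L702–707, Claim 3.3 p0027 L724–744, p0028 L751–760, Claim 3.4 / eq. (3.1) p0029 L766–785,
  Claim 3.8 p0036 L934–943.
-/

noncomputable section

open MvPolynomial
open scoped BigOperators Polynomial

namespace Literature.Computability.AlgebraicComplexity

namespace DDS2021

/-! ### `ε`-adic normal forms of polynomials over `F(ε)` -/

section NormalForm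

variable {F : Type*} [Field F] {σ : Type*}

/-- **`ε`-adic normal form of a nonzero polynomial over `F(ε)`**: `g = c · Ĝ` with `c ∈ F(ε)^×` and
`Ĝ` with coefficients in `F[ε]`, not all vanishing at `ε = 0` — DDS's "extracting the maximum
`ε`-power … `T = ε^{a}·T̃` … `lim_{ε→0} T̃` exists and is non-zero" for polynomials (the scalar
`c` carries the `ε`-adic order and all denominators). From the tree's
`DDS2021.exists_normalize_family` applied to the coefficient family of `g`.
[cite: DuttaDwivediSaxena2022, §2 "Valuation" and §3 proof of Claim 3.3 (full version p0015 L407–410, p0027 L729–733, p0028 L760)] -/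
theorem exists_epsNormalForm (g : MvPolynomial σ (RatFunc F)) (hg : g ≠ 0) :
    ∃ (c : RatFunc F) (G : MvPolynomial σ F[X]), c ≠ 0 ∧
      g = C c * map (algebraMap F[X] (RatFunc F)) G ∧
      map (Polynomial.constantCoeff : F[X] →+* F) G ≠ 0 := by
  classical
  have hne : g.support.Nonempty := by
    rw [Finset.nonempty_iff_ne_empty, Ne, support_eq_empty]
    exact hg
  obtain ⟨m₀, hm₀⟩ := hne
  set α : g.support → RatFunc F := fun m => coeff (m : σ →₀ ℕ) g with hα
  have hα0 : α ≠ 0 := by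
    intro h
    have h1 := congrFun h ⟨m₀, hm₀⟩
    simp only [hα, Pi.zero_apply] at h1
    exact (mem_support_iff.mp hm₀) h1
  obtain ⟨c, β, hc, hαβ, ⟨m₁, hm₁⟩⟩ := exists_normalize_family α hα0
  -- extend `β` by zero off the support
  refine ⟨c, ∑ m ∈ g.support, monomial m (if h : m ∈ g.support then β ⟨m, h⟩ else 0), hc, ?_, ?_⟩
  · ext m
    rw [coeff_C_mul, coeff_map, coeff_sum]
    simp only [coeff_monomial, Finset.sum_ite_eq']
    by_cases hm : m ∈ g.support
    · rw [if_pos hm, dif_pos hm]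
      exact hαβ ⟨m, hm⟩
    · rw [if_neg hm, map_zero, mul_zero]
      exact notMem_support_iff.mp hm
  · intro h0
    have h1 := congrArg (coeff (m₁ : σ →₀ ℕ)) h0
    rw [coeff_map, coeff_sum, coeff_zero] at h1
    simp only [coeff_monomial, Finset.sum_ite_eq'] at h1
    rw [if_pos m₁.2, dif_pos m₁.2] at h1
    exact hm₁ h1

/-- The coefficient embedding `F[ε][x] ↪ F(ε)[x]` is injective. [folklore] -/
private theorem map_algebraMap_injective :
    Function.Injective
      (map (algebraMap F[X] (RatFunc F)) : MvPolynomial σ F[X] → MvPolynomial σ (RatFunc F)) :=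
  map_injective _ (RatFunc.algebraMap_injective F)

/-- Normal forms multiply: the scalars multiply and the integral models multiply (their
reductions at `ε = 0` multiply by `map_mul`, and a product of nonzero reductions is nonzero since
`F[x]` is a domain — the Gauss-lemma content of "`val_ε`" being a valuation, Lemma 2.19/2.20).
[cite: DuttaDwivediSaxena2022, Lemma 2.20 proof (full version p0023 L630–636)] -/
theorem normalForm_mul (c d : RatFunc F) (G H : MvPolynomial σ F[X]) :
    C c * map (algebraMap F[X] (RatFunc F)) G * (C d * map (algebraMap F[X] (RatFunc F)) H) =
      C (c * d) * map (algebraMap F[X] (RatFunc F)) (G * H) := by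
  rw [C_mul, map_mul]
  ring

/-- The reduction at `ε = 0` of a product of integral models is nonzero when both factors reduce
to nonzero polynomials (`F[x]` is a domain). [cite: DuttaDwivediSaxena2022, Lemma 2.20 proof (full version p0023 L630–636)] -/
theorem map_constantCoeff_mul_ne_zero {G H : MvPolynomial σ F[X]}
    (hG : map (Polynomial.constantCoeff : F[X] →+* F) G ≠ 0)
    (hH : map (Polynomial.constantCoeff : F[X] →+* F) H ≠ 0) :
    map (Polynomial.constantCoeff : F[X] →+* F) (G * H) ≠ 0 := by
  rw [map_mul]
  exact mul_ne_zero hG hH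

/-! ### The limit of a proportionality `c · Ĝ = M̂` -/

/-- **Orders are nonnegative against a unit model.** If `C c · N = M` over `F(ε)` with `N, M`
integral (coefficients in `F[ε]`) and `N(ε = 0) ≠ 0`, then the `ε`-adic order of `c` is a natural
number `a`: `c · Q = ε^a · P` with `P(0), Q(0) ≠ 0`, and `ε^a P · N = Q · M` over `F[ε]` ("Since
left side of the equation above is well-defined at `ε = 0`, it must happen that `… ≥ 0`").
[cite: DuttaDwivediSaxena2022, Claim 3.3 proof (full version p0027 L729–735); Lemma 2.20 proof (p0024 L1–4)] -/
theorem exists_ord_of_C_mul_map_eq_map {c : RatFunc F} (hc : c ≠ 0) {N M : MvPolynomial σ F[X]}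
    (hN : map (Polynomial.constantCoeff : F[X] →+* F) N ≠ 0)
    (h : C c * map (algebraMap F[X] (RatFunc F)) N = map (algebraMap F[X] (RatFunc F)) M) :
    ∃ (a : ℕ) (P Q : F[X]), P.coeff 0 ≠ 0 ∧ Q.coeff 0 ≠ 0 ∧
      c * algebraMap F[X] (RatFunc F) Q = algebraMap F[X] (RatFunc F) (Polynomial.X ^ a * P) ∧
      C (Polynomial.X ^ a * P) * N = C Q * M := by
  obtain ⟨a, b, P, Q, hP, hQ, hPQ⟩ := exists_normalize_ne_zero c hc
  have hinj := RatFunc.algebraMap_injective F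
  -- the integral identity `ε^a P · N = ε^b Q · M`
  have key : C (Polynomial.X ^ a * P) * N = C (Polynomial.X ^ b * Q) * M := by
    apply map_algebraMap_injective
    rw [map_mul (map (algebraMap F[X] (RatFunc F))) (C _) N,
      map_mul (map (algebraMap F[X] (RatFunc F))) (C _) M, map_C, map_C, ← hPQ, ← h, C_mul]
    ring
  rcases le_or_gt b a with hba | hab
  · obtain ⟨a', rfl⟩ := Nat.exists_eq_add_of_le hba
    refine ⟨a', P, Q, hP, hQ, ?_, ?_⟩
    · have hXb : algebraMap F[X] (RatFunc F) (Polynomial.X ^ b) ≠ 0 :=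
        (map_ne_zero_iff _ hinj).mpr (pow_ne_zero _ Polynomial.X_ne_zero)
      apply mul_left_cancel₀ hXb
      rw [mul_left_comm, ← map_mul, hPQ, ← map_mul, pow_add, mul_assoc]
    · have hCb : (C (Polynomial.X ^ b) : MvPolynomial σ F[X]) ≠ 0 :=
        C_ne_zero.mpr (pow_ne_zero _ Polynomial.X_ne_zero)
      apply mul_left_cancel₀ hCb
      rw [← mul_assoc, ← mul_assoc, ← C_mul, ← C_mul, ← key, pow_add, mul_assoc]
  · exfalso
    obtain ⟨k, hk⟩ := Nat.exists_eq_add_of_lt hab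
    have hCa : (C (Polynomial.X ^ a) : MvPolynomial σ F[X]) ≠ 0 :=
      C_ne_zero.mpr (pow_ne_zero _ Polynomial.X_ne_zero)
    have key' : C P * N = C (Polynomial.X ^ (k + 1) * Q) * M := by
      apply mul_left_cancel₀ hCa
      rw [← mul_assoc, ← mul_assoc, ← C_mul, ← C_mul, key, hk]
      ring
    have h0 := congrArg (map (Polynomial.constantCoeff : F[X] →+* F)) key'
    have hz : Polynomial.constantCoeff (Polynomial.X ^ (k + 1) * Q) = 0 := by
      rw [Polynomial.constantCoeff_apply, Polynomial.coeff_X_pow_mul',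
        if_neg (Nat.not_le.mpr (Nat.succ_pos k))]
    rw [map_mul (map (Polynomial.constantCoeff : F[X] →+* F)) (C _) N,
      map_mul (map (Polynomial.constantCoeff : F[X] →+* F)) (C _) M, map_C, map_C, hz, C_0,
      zero_mul, Polynomial.constantCoeff_apply] at h0
    exact hN ((mul_eq_zero.mp h0).resolve_left (C_ne_zero.mpr hP))

/-- **The limit of a proportionality.** Under the hypotheses of `exists_ord_of_C_mul_map_eq_map`
the reductions at `ε = 0` are proportional over `F`: `M(0) = u · N(0)`, with `u ≠ 0` as soon as
`M(0) ≠ 0` (order `0`: `u = P(0)/Q(0)`; positive order: `M(0) = 0`, "then `f = 0`, and we have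
trivially de-bordered"). [cite: DuttaDwivediSaxena2022, Claim 3.3 proof (full version p0027 L733–737); Lemma 2.20 proof (p0024 L1–6)] -/
theorem exists_limit_ratio {c : RatFunc F} (hc : c ≠ 0) {N M : MvPolynomial σ F[X]}
    (hN : map (Polynomial.constantCoeff : F[X] →+* F) N ≠ 0)
    (h : C c * map (algebraMap F[X] (RatFunc F)) N = map (algebraMap F[X] (RatFunc F)) M) :
    ∃ u : F, map (Polynomial.constantCoeff : F[X] →+* F) M =
        C u * map (Polynomial.constantCoeff : F[X] →+* F) N ∧
      (map (Polynomial.constantCoeff : F[X] →+* F) M ≠ 0 → u ≠ 0) := by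
  obtain ⟨a, P, Q, hP, hQ, -, hint⟩ := exists_ord_of_C_mul_map_eq_map hc hN h
  have h0 := congrArg (map (Polynomial.constantCoeff : F[X] →+* F)) hint
  rw [map_mul (map (Polynomial.constantCoeff : F[X] →+* F)) (C _) N,
    map_mul (map (Polynomial.constantCoeff : F[X] →+* F)) (C _) M, map_C, map_C] at h0
  rcases Nat.eq_zero_or_pos a with ha | ha
  · subst ha
    rw [pow_zero, one_mul, Polynomial.constantCoeff_apply, Polynomial.constantCoeff_apply] at h0
    refine ⟨P.coeff 0 / Q.coeff 0, ?_, fun _ => div_ne_zero hP hQ⟩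
    have hQ' : (C (Q.coeff 0) : MvPolynomial σ F) ≠ 0 := C_ne_zero.mpr hQ
    apply mul_left_cancel₀ hQ'
    have hPQ0 : Q.coeff 0 * (P.coeff 0 / Q.coeff 0) = P.coeff 0 := by
      field_simp
    rw [← h0, ← mul_assoc, ← C_mul, hPQ0]
  · have hz : Polynomial.constantCoeff (Polynomial.X ^ a * P) = 0 := by
      rw [Polynomial.constantCoeff_apply, Polynomial.coeff_X_pow_mul', if_neg (Nat.not_le.mpr ha)]
    rw [hz, C_0, zero_mul, Polynomial.constantCoeff_apply] at h0
    have hM : map (Polynomial.constantCoeff : F[X] →+* F) M = 0 :=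
      (mul_eq_zero.mp h0.symm).resolve_left (C_ne_zero.mpr hQ)
    exact ⟨0, by rw [hM, C_0, zero_mul], fun hM' => absurd hM hM'⟩

end NormalForm

/-! ### The approximation predicate `MS2021.IsEpsApprox`, unfolded -/

section Approx

variable {F : Type*} [Field F] {n : ℕ}

/-- **Def. 2.1 unfolded**: `g` approximates `f` (same variables) iff `g` has coefficients in `F[ε]`
whose values at `ε = 0` are the coefficients of `f`, i.e. `g = map ι G` with `G(ε = 0) = f`
("`g(x,ε) := f(x) + ε·Q(x,ε)`", `Q ∈ F[ε, x]`). [cite: DuttaDwivediSaxena2022, Def. 2.1 (full version p0016 L416–419)] -/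
theorem isEpsApprox_iff_exists_map {f : MvPolynomial (Fin n) F}
    {g : MvPolynomial (Fin n) (RatFunc F)} :
    MS2021.IsEpsApprox f g ↔ ∃ G : MvPolynomial (Fin n) F[X],
      map (algebraMap F[X] (RatFunc F)) G = g ∧
        map (Polynomial.constantCoeff : F[X] →+* F) G = f := by
  classical
  constructor
  · rintro ⟨hle, h⟩
    have hcast : (Fin.castLE hle : Fin n → Fin n) = id := funext fun i => Fin.ext rfl
    choose p hp hp0 using h
    refine ⟨∑ e ∈ g.support, monomial e (p e), ?_, ?_⟩
    · ext e
      rw [coeff_map, coeff_sum]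
      simp only [coeff_monomial, Finset.sum_ite_eq']
      by_cases he : e ∈ g.support
      · rw [if_pos he, ← hp e]
      · rw [if_neg he, map_zero]
        exact (notMem_support_iff.mp he).symm
    · ext e
      rw [coeff_map, coeff_sum]
      simp only [coeff_monomial, Finset.sum_ite_eq']
      have hfe : (p e).coeff 0 = coeff e f := by
        rw [hp0 e, hcast, rename_id, AlgHom.id_apply]
      by_cases he : e ∈ g.support
      · rw [if_pos he, Polynomial.constantCoeff_apply, hfe]
      · rw [if_neg he, map_zero]
        have hpe : p e = 0 := by
          apply RatFunc.algebraMap_injective F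
          rw [← hp e, map_zero]
          exact notMem_support_iff.mp he
        rw [← hfe, hpe, Polynomial.coeff_zero]
  · rintro ⟨G, hGg, hGf⟩
    refine ⟨le_rfl, fun e => ⟨coeff e G, ?_, ?_⟩⟩
    · rw [← hGg, coeff_map]
    · have hcast : (Fin.castLE (le_refl n) : Fin n → Fin n) = id := funext fun i => Fin.ext rfl
      rw [hcast, rename_id, AlgHom.id_apply, ← hGf, coeff_map, Polynomial.constantCoeff_apply]

/-- **Border membership unfolded** (Def. 2.1): `f ∈ \overline{𝒞}` iff some integral `G ∈ F[ε][x]`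
with `G(ε = 0) = f` lies, read over `F(ε)`, in the class `𝒞_{F(ε)}`.
[cite: DuttaDwivediSaxena2022, Def. 2.1 (full version p0016 L416–419)] -/
theorem mem_border_iff {𝒞 : Set (MvPolynomial (Fin n) (RatFunc F))} {f : MvPolynomial (Fin n) F} :
    f ∈ border 𝒞 ↔ ∃ G : MvPolynomial (Fin n) F[X],
      map (algebraMap F[X] (RatFunc F)) G ∈ 𝒞 ∧
        map (Polynomial.constantCoeff : F[X] →+* F) G = f := by
  constructor
  · rintro ⟨g, hg, hfg⟩
    obtain ⟨G, hGg, hGf⟩ := isEpsApprox_iff_exists_map.mp hfg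
    exact ⟨G, hGg ▸ hg, hGf⟩
  · rintro ⟨G, hG, hGf⟩
    exact ⟨_, hG, isEpsApprox_iff_exists_map.mpr ⟨G, rfl, hGf⟩⟩

/-- The reduction at `ε = 0` of an integral member of `𝒞_{F(ε)}` lies in the border of `𝒞`
("Note that `ĝ_i ∈ \overline{𝒞}`", Lemma 2.20 proof). [cite: DuttaDwivediSaxena2022, Lemma 2.20 proof (full version p0023 L633–634)] -/
theorem map_constantCoeff_mem_border {𝒞 : Set (MvPolynomial (Fin n) (RatFunc F))}
    {G : MvPolynomial (Fin n) F[X]} (hG : map (algebraMap F[X] (RatFunc F)) G ∈ 𝒞) :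
    map (Polynomial.constantCoeff : F[X] →+* F) G ∈ border 𝒞 :=
  mem_border_iff.mpr ⟨G, hG, rfl⟩

end Approx

/-! ### Lemma 2.20: de-bordering a bloated product-ratio class -/

section BloatedRatio

variable {F : Type*} [Field F] {n : ℕ}

/-- A member of a class closed under nonzero `F(ε)`-scalars has an `ε`-adic normal form whose
reduction at `ε = 0` lies in the border of the class ("Denote `g_i =: ε^{a_i} · g̃_i` … Note that
`ĝ_i ∈ \overline{𝒞}`"); the zero polynomial is represented by `0 = C 0 · 0`.
[cite: DuttaDwivediSaxena2022, Lemma 2.20 proof (full version p0023 L632–634)] -/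
theorem exists_border_rep_of_C_mul_mem {𝒞 : Set (MvPolynomial (Fin n) (RatFunc F))}
    (h𝒞 : ∀ c : RatFunc F, c ≠ 0 → ∀ g ∈ 𝒞, C c * g ∈ 𝒞) {g : MvPolynomial (Fin n) (RatFunc F)}
    (hg : g ∈ 𝒞) :
    ∃ (c : RatFunc F) (G : MvPolynomial (Fin n) F[X]),
      g = C c * map (algebraMap F[X] (RatFunc F)) G ∧
        map (Polynomial.constantCoeff : F[X] →+* F) G ∈ border 𝒞 ∧
          (g ≠ 0 → c ≠ 0 ∧ map (Polynomial.constantCoeff : F[X] →+* F) G ≠ 0) := by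
  by_cases hg0 : g = 0
  · refine ⟨0, 0, by rw [hg0, C_0, zero_mul], ?_, fun h => absurd hg0 h⟩
    have h0 : map (algebraMap F[X] (RatFunc F)) (0 : MvPolynomial (Fin n) F[X]) ∈ 𝒞 := by
      rw [map_zero, ← hg0]
      exact hg
    exact map_constantCoeff_mem_border h0
  · obtain ⟨c, G, hc, hgc, hG⟩ := exists_epsNormalForm g hg0
    refine ⟨c, G, hgc, map_constantCoeff_mem_border ?_, fun _ => ⟨hc, hG⟩⟩
    have h1 : map (algebraMap F[X] (RatFunc F)) G = C c⁻¹ * g := by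
      rw [hgc, ← mul_assoc, ← C_mul, inv_mul_cancel₀ hc, C_1, one_mul]
    rw [h1]
    exact h𝒞 _ (inv_ne_zero hc) g hg

/-- **Lemma 2.20, core form (representatives supplied).** If `g₁ h₁ · E = M · g₂ h₂` over `F(ε)`
with `E, M` integral, `E(0) ≠ 0`, `g₂ h₂ ≠ 0`, and each of `g₁, g₂, h₁, h₂` has an `ε`-adic normal
form `C cᵢ · Ĝᵢ` whose reduction lies in the border of its class, then the reductions satisfy
`M(0) · Ĝ₂(0) Ĥ₂(0) = u · Ĝ₁(0) Ĥ₁(0) · E(0)` for a scalar `u ∈ F`, nonzero when `M(0) ≠ 0`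
("`ε^{a₁−a₂+b₁−b₂} · (g̃₁/g̃₂)·(h̃₁/h̃₂) = f + ε·Q` … if it is greater than one, then `f = 0` …
if `= 0`, then `f = (ĝ₁/ĝ₂)·(ĥ₁/ĥ₂)`").
[cite: DuttaDwivediSaxena2022, Lemma 2.20 and its proof (full version p0023 L632–636, p0024 L1–6)] -/
theorem border_mulDiv_of_reps {𝒞 𝒟 : Set (MvPolynomial (Fin n) (RatFunc F))}
    {g₁ g₂ h₁ h₂ : MvPolynomial (Fin n) (RatFunc F)} (hg₂0 : g₂ ≠ 0) (hh₂0 : h₂ ≠ 0)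
    (rg₁ : ∃ (c : RatFunc F) (G : MvPolynomial (Fin n) F[X]),
      g₁ = C c * map (algebraMap F[X] (RatFunc F)) G ∧
        map (Polynomial.constantCoeff : F[X] →+* F) G ∈ border 𝒞 ∧
          (g₁ ≠ 0 → c ≠ 0 ∧ map (Polynomial.constantCoeff : F[X] →+* F) G ≠ 0))
    (rg₂ : ∃ (c : RatFunc F) (G : MvPolynomial (Fin n) F[X]),
      g₂ = C c * map (algebraMap F[X] (RatFunc F)) G ∧
        map (Polynomial.constantCoeff : F[X] →+* F) G ∈ border 𝒞 ∧
          (g₂ ≠ 0 → c ≠ 0 ∧ map (Polynomial.constantCoeff : F[X] →+* F) G ≠ 0))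
    (rh₁ : ∃ (c : RatFunc F) (G : MvPolynomial (Fin n) F[X]),
      h₁ = C c * map (algebraMap F[X] (RatFunc F)) G ∧
        map (Polynomial.constantCoeff : F[X] →+* F) G ∈ border 𝒟 ∧
          (h₁ ≠ 0 → c ≠ 0 ∧ map (Polynomial.constantCoeff : F[X] →+* F) G ≠ 0))
    (rh₂ : ∃ (c : RatFunc F) (G : MvPolynomial (Fin n) F[X]),
      h₂ = C c * map (algebraMap F[X] (RatFunc F)) G ∧
        map (Polynomial.constantCoeff : F[X] →+* F) G ∈ border 𝒟 ∧
          (h₂ ≠ 0 → c ≠ 0 ∧ map (Polynomial.constantCoeff : F[X] →+* F) G ≠ 0))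
    {E M : MvPolynomial (Fin n) F[X]} (hE : map (Polynomial.constantCoeff : F[X] →+* F) E ≠ 0)
    (heq : g₁ * h₁ * map (algebraMap F[X] (RatFunc F)) E =
      map (algebraMap F[X] (RatFunc F)) M * (g₂ * h₂)) :
    ∃ G₁ G₂ H₁ H₂ : MvPolynomial (Fin n) F,
      G₁ ∈ border 𝒞 ∧ G₂ ∈ border 𝒞 ∧ H₁ ∈ border 𝒟 ∧ H₂ ∈ border 𝒟 ∧ G₂ ≠ 0 ∧ H₂ ≠ 0 ∧
      ∃ u : F, map (Polynomial.constantCoeff : F[X] →+* F) M * (G₂ * H₂) =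
          C u * (G₁ * H₁) * map (Polynomial.constantCoeff : F[X] →+* F) E ∧
        (map (Polynomial.constantCoeff : F[X] →+* F) M ≠ 0 → u ≠ 0) := by
  obtain ⟨c₁, G₁, hg₁, hG₁b, hG₁nz⟩ := rg₁
  obtain ⟨c₂, G₂, hg₂, hG₂b, hG₂nz⟩ := rg₂
  obtain ⟨d₁, H₁, hh₁, hH₁b, hH₁nz⟩ := rh₁
  obtain ⟨d₂, H₂, hh₂, hH₂b, hH₂nz⟩ := rh₂
  obtain ⟨hc₂, hG₂⟩ := hG₂nz hg₂0
  obtain ⟨hd₂, hH₂⟩ := hH₂nz hh₂0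
  refine ⟨_, _, _, _, hG₁b, hG₂b, hH₁b, hH₂b, hG₂, hH₂, ?_⟩
  by_cases h10 : g₁ * h₁ = 0
  · -- then `M = 0`: "trivially de-bordered"
    have hM : M = 0 := by
      apply map_algebraMap_injective (F := F) (σ := Fin n)
      rw [h10, zero_mul] at heq
      rw [map_zero]
      exact (mul_eq_zero.mp heq.symm).resolve_right (mul_ne_zero hg₂0 hh₂0)
    refine ⟨0, ?_, fun h => ?_⟩
    · rw [hM, map_zero, zero_mul, C_0, zero_mul, zero_mul]
    · exact absurd (by rw [hM, map_zero]) h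
  · obtain ⟨hc₁, hG₁⟩ := hG₁nz (left_ne_zero_of_mul h10)
    obtain ⟨hd₁, hH₁⟩ := hH₁nz (right_ne_zero_of_mul h10)
    have hc : c₁ * d₁ / (c₂ * d₂) ≠ 0 :=
      div_ne_zero (mul_ne_zero hc₁ hd₁) (mul_ne_zero hc₂ hd₂)
    have hN : map (Polynomial.constantCoeff : F[X] →+* F) (G₁ * H₁ * E) ≠ 0 :=
      map_constantCoeff_mul_ne_zero (map_constantCoeff_mul_ne_zero hG₁ hH₁) hE
    have key : C (c₁ * d₁ / (c₂ * d₂)) * map (algebraMap F[X] (RatFunc F)) (G₁ * H₁ * E) =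
        map (algebraMap F[X] (RatFunc F)) (M * (G₂ * H₂)) := by
      have h22 : (C (c₂ * d₂) : MvPolynomial (Fin n) (RatFunc F)) ≠ 0 :=
        C_ne_zero.mpr (mul_ne_zero hc₂ hd₂)
      apply mul_left_cancel₀ h22
      have hcd : c₂ * d₂ * (c₁ * d₁ / (c₂ * d₂)) = c₁ * d₁ := by
        field_simp
      rw [← mul_assoc, ← C_mul, hcd]
      rw [hg₁, hh₁, hg₂, hh₂] at heq
      simp only [map_mul]
      linear_combination heq
    obtain ⟨u, hu, hu0⟩ := exists_limit_ratio hc hN key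
    refine ⟨u, ?_, fun hM => hu0 ?_⟩
    · simp only [map_mul] at hu
      linear_combination hu
    · rw [map_mul]
      exact mul_ne_zero hM (map_constantCoeff_mul_ne_zero hG₂ hH₂)

/-- **DDS Lemma 2.20 (`\overline{(𝒞/𝒞)·(𝒟/𝒟)} ⊆ (\overline{𝒞}/\overline{𝒞})·(\overline{𝒟}/\overline{𝒟})`),
PROVED** for classes `𝒞, 𝒟` of polynomials over `F(ε)` closed under nonzero `F(ε)`-scalars (as all
of DDS's circuit classes are), in polynomial-cleared form: if `g₁ h₁ · E = M · g₂ h₂` with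
`gᵢ ∈ 𝒞`, `hᵢ ∈ 𝒟`, `g₂ h₂ ≠ 0` and `E, M` integral with `E(0) ≠ 0` — i.e. the bloated element
`(g₁/g₂)·(h₁/h₂)` equals the `ε`-integral fraction `M/E` — then its limit `M(0)/E(0)` is
`u · (Ĝ₁/Ĝ₂)·(Ĥ₁/Ĥ₂)` with `Ĝᵢ ∈ \overline{𝒞}`, `Ĥᵢ ∈ \overline{𝒟}`, `Ĝ₂ Ĥ₂ ≠ 0`, `u ∈ F`
(`u ≠ 0` unless the limit vanishes): `M(0) · Ĝ₂ Ĥ₂ = u · Ĝ₁ Ĥ₁ · E(0)`. The printed "`= f + ε·Q`"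
instance is `border_mulDiv_ratio`. [cite: DuttaDwivediSaxena2022, Lemma 2.20 (full version p0023 L628–636; proof p0023–p0024)] -/
theorem border_mulDiv {𝒞 𝒟 : Set (MvPolynomial (Fin n) (RatFunc F))}
    (h𝒞 : ∀ c : RatFunc F, c ≠ 0 → ∀ g ∈ 𝒞, C c * g ∈ 𝒞)
    (h𝒟 : ∀ c : RatFunc F, c ≠ 0 → ∀ g ∈ 𝒟, C c * g ∈ 𝒟)
    {g₁ g₂ h₁ h₂ : MvPolynomial (Fin n) (RatFunc F)} (hg₁ : g₁ ∈ 𝒞) (hg₂ : g₂ ∈ 𝒞)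
    (hh₁ : h₁ ∈ 𝒟) (hh₂ : h₂ ∈ 𝒟) (hg₂0 : g₂ ≠ 0) (hh₂0 : h₂ ≠ 0)
    {E M : MvPolynomial (Fin n) F[X]} (hE : map (Polynomial.constantCoeff : F[X] →+* F) E ≠ 0)
    (heq : g₁ * h₁ * map (algebraMap F[X] (RatFunc F)) E =
      map (algebraMap F[X] (RatFunc F)) M * (g₂ * h₂)) :
    ∃ G₁ G₂ H₁ H₂ : MvPolynomial (Fin n) F,
      G₁ ∈ border 𝒞 ∧ G₂ ∈ border 𝒞 ∧ H₁ ∈ border 𝒟 ∧ H₂ ∈ border 𝒟 ∧ G₂ ≠ 0 ∧ H₂ ≠ 0 ∧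
      ∃ u : F, map (Polynomial.constantCoeff : F[X] →+* F) M * (G₂ * H₂) =
          C u * (G₁ * H₁) * map (Polynomial.constantCoeff : F[X] →+* F) E ∧
        (map (Polynomial.constantCoeff : F[X] →+* F) M ≠ 0 → u ≠ 0) :=
  border_mulDiv_of_reps hg₂0 hh₂0 (exists_border_rep_of_C_mul_mem h𝒞 hg₁)
    (exists_border_rep_of_C_mul_mem h𝒞 hg₂) (exists_border_rep_of_C_mul_mem h𝒟 hh₁)
    (exists_border_rep_of_C_mul_mem h𝒟 hh₂) hE heq

/-- The embedding `F ↪ F(ε)` factors through `F[ε]`. [folklore] -/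
private theorem algebraMap_comp_C :
    (algebraMap F[X] (RatFunc F)).comp Polynomial.C = algebraMap F (RatFunc F) := by
  ext a
  rw [RingHom.comp_apply, RatFunc.algebraMap_C, RatFunc.algebraMap_eq_C]

/-- Bookkeeping for the printed target "`f + ε·Q`" with `f = f₁/f₂ ∈ F(x)` and `Q = S/D`:
the integral fraction `M/E` with `E = f₂·D`, `M = f₁·D + ε·S·f₂`, read over `F(ε)` and at `ε = 0`.
[folklore] -/
private theorem ratio_instance (f₁ f₂ : MvPolynomial (Fin n) F) (S D : MvPolynomial (Fin n) F[X]) :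
    map (algebraMap F[X] (RatFunc F)) (map Polynomial.C f₂ * D) =
        map (algebraMap F (RatFunc F)) f₂ * map (algebraMap F[X] (RatFunc F)) D ∧
      map (algebraMap F[X] (RatFunc F))
          (map Polynomial.C f₁ * D + C Polynomial.X * (S * map Polynomial.C f₂)) =
        map (algebraMap F (RatFunc F)) f₁ * map (algebraMap F[X] (RatFunc F)) D +
          C (algebraMap F[X] (RatFunc F) Polynomial.X) *
            (map (algebraMap F[X] (RatFunc F)) S * map (algebraMap F (RatFunc F)) f₂) ∧
      map (Polynomial.constantCoeff : F[X] →+* F) (map Polynomial.C f₂ * D) =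
        f₂ * map (Polynomial.constantCoeff : F[X] →+* F) D ∧
      map (Polynomial.constantCoeff : F[X] →+* F)
          (map Polynomial.C f₁ * D + C Polynomial.X * (S * map Polynomial.C f₂)) =
        f₁ * map (Polynomial.constantCoeff : F[X] →+* F) D := by
  have hK : ∀ f : MvPolynomial (Fin n) F,
      map (algebraMap F[X] (RatFunc F)) (map Polynomial.C f) = map (algebraMap F (RatFunc F)) f :=
    fun f => by rw [map_map, algebraMap_comp_C]
  have h0 : ∀ f : MvPolynomial (Fin n) F,
      map (Polynomial.constantCoeff : F[X] →+* F) (map Polynomial.C f) = f := fun f => by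
    rw [map_map]
    have hid : (Polynomial.constantCoeff : F[X] →+* F).comp Polynomial.C = RingHom.id F := by
      ext a
      rw [RingHom.comp_apply, Polynomial.constantCoeff_apply, Polynomial.coeff_C_zero,
        RingHom.id_apply]
    rw [hid, map_id]
  refine ⟨?_, ?_, ?_, ?_⟩
  · rw [map_mul, hK]
  · rw [map_add, map_mul, map_mul, map_mul, map_C, hK, hK]
  · rw [map_mul, h0]
  · rw [map_add, map_mul, map_mul, map_mul, map_C, h0, h0, Polynomial.constantCoeff_apply,
      Polynomial.coeff_X_zero, C_0, zero_mul, add_zero]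

/-- **DDS Lemma 2.20 with the printed target** "`(g₁/g₂)·(h₁/h₂) = f + ε·Q`", `f = f₁/f₂ ∈ F(x)`,
`Q = S/D` an `ε`-integral fraction (`D(0) ≠ 0`), cleared of denominators:
`g₁ h₁ · f₂ D = (f₁ D + ε·S f₂) · g₂ h₂`. Conclusion: `f₁ · Ĝ₂ Ĥ₂ = u · Ĝ₁ Ĥ₁ · f₂` with
`Ĝᵢ ∈ \overline{𝒞}`, `Ĥᵢ ∈ \overline{𝒟}`, `Ĝ₂ Ĥ₂ ≠ 0`, and `u ≠ 0` unless `f₁ = 0` — "Since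
`lim_{ε→0}` exists, the exponent `… ≥ 0`. If it is greater than one, then `f = 0`. Moreover, if
`… = 0`, then `f = (ĝ₁/ĝ₂)·(ĥ₁/ĥ₂) ∈ (\overline{𝒞}/\overline{𝒞})·(\overline{𝒟}/\overline{𝒟})`."
[cite: DuttaDwivediSaxena2022, Lemma 2.20 (full version p0023 L628–636; proof p0023–p0024)] -/
theorem border_mulDiv_ratio {𝒞 𝒟 : Set (MvPolynomial (Fin n) (RatFunc F))}
    (h𝒞 : ∀ c : RatFunc F, c ≠ 0 → ∀ g ∈ 𝒞, C c * g ∈ 𝒞)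
    (h𝒟 : ∀ c : RatFunc F, c ≠ 0 → ∀ g ∈ 𝒟, C c * g ∈ 𝒟)
    {g₁ g₂ h₁ h₂ : MvPolynomial (Fin n) (RatFunc F)} (hg₁ : g₁ ∈ 𝒞) (hg₂ : g₂ ∈ 𝒞)
    (hh₁ : h₁ ∈ 𝒟) (hh₂ : h₂ ∈ 𝒟) (hg₂0 : g₂ ≠ 0) (hh₂0 : h₂ ≠ 0)
    {f₁ f₂ : MvPolynomial (Fin n) F} (hf₂ : f₂ ≠ 0) {S D : MvPolynomial (Fin n) F[X]}
    (hD : map (Polynomial.constantCoeff : F[X] →+* F) D ≠ 0)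
    (happrox : g₁ * h₁ * (map (algebraMap F (RatFunc F)) f₂ * map (algebraMap F[X] (RatFunc F)) D) =
      (map (algebraMap F (RatFunc F)) f₁ * map (algebraMap F[X] (RatFunc F)) D +
          C (algebraMap F[X] (RatFunc F) Polynomial.X) *
            (map (algebraMap F[X] (RatFunc F)) S * map (algebraMap F (RatFunc F)) f₂)) *
        (g₂ * h₂)) :
    ∃ G₁ G₂ H₁ H₂ : MvPolynomial (Fin n) F,
      G₁ ∈ border 𝒞 ∧ G₂ ∈ border 𝒞 ∧ H₁ ∈ border 𝒟 ∧ H₂ ∈ border 𝒟 ∧ G₂ ≠ 0 ∧ H₂ ≠ 0 ∧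
      ∃ u : F, f₁ * (G₂ * H₂) = C u * (G₁ * H₁) * f₂ ∧ (f₁ ≠ 0 → u ≠ 0) := by
  obtain ⟨hE, hM, hE0, hM0⟩ := ratio_instance (F := F) f₁ f₂ S D
  rw [← hE, ← hM] at happrox
  have hE' : map (Polynomial.constantCoeff : F[X] →+* F) (map Polynomial.C f₂ * D) ≠ 0 := by
    rw [hE0]
    exact mul_ne_zero hf₂ hD
  obtain ⟨G₁, G₂, H₁, H₂, hG₁, hG₂, hH₁, hH₂, hG₂0, hH₂0, u, hu, hu0⟩ :=
    border_mulDiv h𝒞 h𝒟 hg₁ hg₂ hh₁ hh₂ hg₂0 hh₂0 hE' happrox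
  rw [hE0, hM0] at hu
  rw [hM0] at hu0
  refine ⟨G₁, G₂, H₁, H₂, hG₁, hG₂, hH₁, hH₂, hG₂0, hH₂0, u, ?_, fun hf₁ => hu0 (mul_ne_zero hf₁ hD)⟩
  apply mul_right_cancel₀ hD
  linear_combination hu

end BloatedRatio

/-! ### Claim 3.3, the `ε`-side: de-bordering `Gen(1,·) = (ΠΣ/ΠΣ)·(Σ∧Σ/Σ∧Σ)` -/

section GenOne

variable {F : Type*} [Field F] {n : ℕ}

/-- Scaling an affine form scales its coefficients. [folklore] -/
private theorem C_mul_affine {R : Type*} [CommSemiring R] (c : R) (β : Option (Fin n) → R) :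
    C c * (C (β none) + ∑ m, C (β (some m)) * X m : MvPolynomial (Fin n) R) =
      C (c * β none) + ∑ m, C (c * β (some m)) * X m := by
  rw [mul_add, ← C_mul, Finset.mul_sum]
  refine congrArg _ (Finset.sum_congr rfl fun m _ => ?_)
  rw [← mul_assoc, ← C_mul]

/-- `ΠΣ` with at least one factor is closed under scalars (absorb the scalar into the first affine
form; Def. 3.1's `U_i, V_i ∈ ΠΣ` over the ring `R(ε)`).
[cite: DuttaDwivediSaxena2022, Def. 3.1 (full version p0026 L702–707)] -/
theorem C_mul_mem_spsClass_one_succ {K : Type*} [Field K] {d : ℕ} (c : K)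
    {g : MvPolynomial (Fin n) K} (hg : g ∈ spsClass K n 1 (d + 1)) :
    C c * g ∈ spsClass K n 1 (d + 1) := by
  obtain ⟨α, rfl⟩ := hg
  refine ⟨fun i j o => if j = 0 then c * α i j o else α i j o, ?_⟩
  rw [Fin.sum_univ_one, Fin.sum_univ_one, Fin.prod_univ_succ, Fin.prod_univ_succ, ← mul_assoc]
  -- (`congr 1` closes the factors `j.succ`, whose `if j.succ = 0` reduces definitionally)
  congr 1
  rw [C_mul_affine]
  simp

/-- Normal-form representatives for `ΠΣ = Σ^{[1]}Π^{[d]}Σ` over `F(ε)`, for every `d` (for `d = 0`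
the class is `{1}`, represented by `1 = C 1 · 1`). [cite: DuttaDwivediSaxena2022, Claim 3.3 proof (full version p0027 L729–744)] -/
theorem exists_border_rep_spsClass_one {d : ℕ} {g : MvPolynomial (Fin n) (RatFunc F)}
    (hg : g ∈ spsClass (RatFunc F) n 1 d) :
    ∃ (c : RatFunc F) (G : MvPolynomial (Fin n) F[X]),
      g = C c * map (algebraMap F[X] (RatFunc F)) G ∧
        map (Polynomial.constantCoeff : F[X] →+* F) G ∈ border (spsClass (RatFunc F) n 1 d) ∧
          (g ≠ 0 → c ≠ 0 ∧ map (Polynomial.constantCoeff : F[X] →+* F) G ≠ 0) := by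
  cases d with
  | zero =>
    obtain ⟨α, hα⟩ := hg
    have hg1 : g = 1 := by
      rw [hα, Fin.sum_univ_one, Finset.univ_eq_empty, Finset.prod_empty]
    refine ⟨1, 1, by rw [hg1, C_1, map_one, one_mul], ?_, fun _ => ⟨one_ne_zero, ?_⟩⟩
    · apply map_constantCoeff_mem_border
      rw [map_one, ← hg1]
      exact ⟨α, hα⟩
    · rw [map_one]
      exact one_ne_zero
  | succ d =>
    exact exists_border_rep_of_C_mul_mem (fun c _ g hg => C_mul_mem_spsClass_one_succ c hg) hg

/-- **DDS Claim 3.3, the `ε → 0` step, PROVED** ("`\overline{Gen(1,s)} ⊆ ABP/ABP`" up to the ABP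
conversion): if a `Gen(1,·)` element `(U/V)·(P/Q)` over `F(ε)` — `U, V ∈ ΠΣ = Σ^{[1]}Π^{[d]}Σ`,
`P, Q ∈ Σ∧Σ`, `V Q ≠ 0` (Def. 3.1) — equals an `ε`-integral fraction `M/E` (`E(0) ≠ 0`;
cleared: `U P · E = M · V Q`), then its limit is a `Gen(1,·)`-type element over `F` with de-bordered
factors: `M(0) · V₀ Q₀ = u · U₀ P₀ · E(0)` with `U₀, V₀ ∈ ΠΣ` over `F` (by `\overline{ΠΣ} = ΠΣ`,
`isSPS_one_of_isEpsApprox`), `P₀, Q₀ ∈ \overline{Σ∧Σ}`, `V₀ Q₀ ≠ 0` — "`f = (lim Ũ/lim Ṽ)·(lim P̃/lim Q̃)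
∈ (ΠΣ/ΠΣ)·(ARO/ARO)`", the ARO/ABP reading of `\overline{Σ∧Σ}` (Lemma 2.23) being left to
`DDS21DeborderReadOnce.lean`. [cite: DuttaDwivediSaxena2022, Def. 3.1 and Claim 3.3 with proof (full version p0026 L702–707, p0027 L724–744)] -/
theorem deborder_gen_one {d t e : ℕ} {U V P Q : MvPolynomial (Fin n) (RatFunc F)}
    (hU : U ∈ spsClass (RatFunc F) n 1 d) (hV : V ∈ spsClass (RatFunc F) n 1 d)
    (hP : P ∈ swsClass (RatFunc F) n t e) (hQ : Q ∈ swsClass (RatFunc F) n t e)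
    (hV0 : V ≠ 0) (hQ0 : Q ≠ 0) {E M : MvPolynomial (Fin n) F[X]}
    (hE : map (Polynomial.constantCoeff : F[X] →+* F) E ≠ 0)
    (heq : U * P * map (algebraMap F[X] (RatFunc F)) E =
      map (algebraMap F[X] (RatFunc F)) M * (V * Q)) :
    ∃ U₀ V₀ P₀ Q₀ : MvPolynomial (Fin n) F,
      U₀ ∈ spsClass F n 1 d ∧ V₀ ∈ spsClass F n 1 d ∧
      P₀ ∈ border (swsClass (RatFunc F) n t e) ∧ Q₀ ∈ border (swsClass (RatFunc F) n t e) ∧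
      V₀ ≠ 0 ∧ Q₀ ≠ 0 ∧
      ∃ u : F, map (Polynomial.constantCoeff : F[X] →+* F) M * (V₀ * Q₀) =
          C u * (U₀ * P₀) * map (Polynomial.constantCoeff : F[X] →+* F) E ∧
        (map (Polynomial.constantCoeff : F[X] →+* F) M ≠ 0 → u ≠ 0) := by
  -- `Σ∧Σ` is closed under scalars: `C_mul_mem_swsClass` (DDS21DepthThreeDiagonalToolkit.lean)
  have h𝒟 : ∀ c : RatFunc F, c ≠ 0 → ∀ g ∈ swsClass (RatFunc F) n t e,
      C c * g ∈ swsClass (RatFunc F) n t e := fun c _ g hg => C_mul_mem_swsClass c hg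
  obtain ⟨U₀, V₀, P₀, Q₀, hU₀, hV₀, hP₀, hQ₀, hV₀0, hQ₀0, hu⟩ :=
    border_mulDiv_of_reps hV0 hQ0 (exists_border_rep_spsClass_one hU)
      (exists_border_rep_spsClass_one hV) (exists_border_rep_of_C_mul_mem h𝒟 hP)
      (exists_border_rep_of_C_mul_mem h𝒟 hQ) hE heq
  obtain ⟨gU, hgU, hgU'⟩ := hU₀
  obtain ⟨gV, hgV, hgV'⟩ := hV₀
  exact ⟨U₀, V₀, P₀, Q₀, isSPS_one_of_isEpsApprox hgU hgU', isSPS_one_of_isEpsApprox hgV hgV',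
    hP₀, hQ₀, hV₀0, hQ₀0, hu⟩

/-- **Claim 3.3 with the printed target** "`g(x,ε) = (U/V)·(P/Q) = f(x) + ε·S(x,ε)`", `f = f₁/f₂`,
the error an `ε`-integral fraction `S/D` (`D(0) ≠ 0`), cleared of denominators:
`U P · f₂ D = (f₁ D + ε·S f₂) · V Q`. Then `f₁ · V₀ Q₀ = u · U₀ P₀ · f₂` with `U₀, V₀ ∈ ΠΣ` over `F`,
`P₀, Q₀ ∈ \overline{Σ∧Σ}`, `V₀ Q₀ ≠ 0`, `u ≠ 0` unless `f₁ = 0` ("If `… ≥ 1`, then `f = 0` …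
Therefore, we can assume `… = 0` which implies that `f = (lim Ũ/lim Ṽ)·(lim P̃/lim Q̃)`").
[cite: DuttaDwivediSaxena2022, Claim 3.3 with proof (full version p0027 L724–744)] -/
theorem deborder_gen_one_ratio {d t e : ℕ} {U V P Q : MvPolynomial (Fin n) (RatFunc F)}
    (hU : U ∈ spsClass (RatFunc F) n 1 d) (hV : V ∈ spsClass (RatFunc F) n 1 d)
    (hP : P ∈ swsClass (RatFunc F) n t e) (hQ : Q ∈ swsClass (RatFunc F) n t e)
    (hV0 : V ≠ 0) (hQ0 : Q ≠ 0) {f₁ f₂ : MvPolynomial (Fin n) F} (hf₂ : f₂ ≠ 0)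
    {S D : MvPolynomial (Fin n) F[X]} (hD : map (Polynomial.constantCoeff : F[X] →+* F) D ≠ 0)
    (happrox : U * P * (map (algebraMap F (RatFunc F)) f₂ * map (algebraMap F[X] (RatFunc F)) D) =
      (map (algebraMap F (RatFunc F)) f₁ * map (algebraMap F[X] (RatFunc F)) D +
          C (algebraMap F[X] (RatFunc F) Polynomial.X) *
            (map (algebraMap F[X] (RatFunc F)) S * map (algebraMap F (RatFunc F)) f₂)) *
        (V * Q)) :
    ∃ U₀ V₀ P₀ Q₀ : MvPolynomial (Fin n) F,
      U₀ ∈ spsClass F n 1 d ∧ V₀ ∈ spsClass F n 1 d ∧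
      P₀ ∈ border (swsClass (RatFunc F) n t e) ∧ Q₀ ∈ border (swsClass (RatFunc F) n t e) ∧
      V₀ ≠ 0 ∧ Q₀ ≠ 0 ∧
      ∃ u : F, f₁ * (V₀ * Q₀) = C u * (U₀ * P₀) * f₂ ∧ (f₁ ≠ 0 → u ≠ 0) := by
  obtain ⟨hE, hM, hE0, hM0⟩ := ratio_instance (F := F) f₁ f₂ S D
  rw [← hE, ← hM] at happrox
  have hE' : map (Polynomial.constantCoeff : F[X] →+* F) (map Polynomial.C f₂ * D) ≠ 0 := by
    rw [hE0]
    exact mul_ne_zero hf₂ hD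
  obtain ⟨U₀, V₀, P₀, Q₀, hU₀, hV₀, hP₀, hQ₀, hV₀0, hQ₀0, u, hu, hu0⟩ :=
    deborder_gen_one hU hV hP hQ hV0 hQ0 hE' happrox
  rw [hE0, hM0] at hu
  rw [hM0] at hu0
  refine ⟨U₀, V₀, P₀, Q₀, hU₀, hV₀, hP₀, hQ₀, hV₀0, hQ₀0, u, ?_,
    fun hf₁ => hu0 (mul_ne_zero hf₁ hD)⟩
  apply mul_right_cancel₀ hD
  linear_combination hu

end GenOne

/-! ### `ε → 0` commutes with the ring operations, `F`-substitutions and `∂` (Def. 2.1 calculus) -/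

section ApproxCalculus

variable {F : Type*} [Field F] {n m : ℕ}

/-- **The limit is unique**: a polynomial over `F(ε)` approximates at most one polynomial over `F`
(its coefficientwise value at `ε = 0`; "`lim_{ε→0} g = f`", Def. 2.1 / Claim 3.4).
[cite: DuttaDwivediSaxena2022, Def. 2.1 (full version p0016 L416–419); Claim 3.4 (p0029 L772)] -/
theorem _root_.Literature.Computability.AlgebraicComplexity.MS2021.IsEpsApprox.unique
    {f f' : MvPolynomial (Fin n) F} {g : MvPolynomial (Fin n) (RatFunc F)}
    (h : MS2021.IsEpsApprox f g) (h' : MS2021.IsEpsApprox f' g) : f = f' := by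
  obtain ⟨G, hG, hGf⟩ := isEpsApprox_iff_exists_map.mp h
  obtain ⟨G', hG', hGf'⟩ := isEpsApprox_iff_exists_map.mp h'
  have hGG : G = G' := map_algebraMap_injective (hG.trans hG'.symm)
  rw [← hGf, ← hGf', hGG]

/-- `lim_{ε→0}` is additive. [cite: DuttaDwivediSaxena2022, Def. 2.1 (full version p0016 L416–419)] -/
theorem _root_.Literature.Computability.AlgebraicComplexity.MS2021.IsEpsApprox.add
    {f f' : MvPolynomial (Fin n) F} {g g' : MvPolynomial (Fin n) (RatFunc F)}
    (h : MS2021.IsEpsApprox f g) (h' : MS2021.IsEpsApprox f' g') :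
    MS2021.IsEpsApprox (f + f') (g + g') := by
  obtain ⟨G, rfl, rfl⟩ := isEpsApprox_iff_exists_map.mp h
  obtain ⟨G', rfl, rfl⟩ := isEpsApprox_iff_exists_map.mp h'
  exact isEpsApprox_iff_exists_map.mpr ⟨G + G', by rw [map_add], by rw [map_add]⟩

/-- `lim_{ε→0}` is multiplicative. [cite: DuttaDwivediSaxena2022, Def. 2.1 (full version p0016 L416–419)] -/
theorem _root_.Literature.Computability.AlgebraicComplexity.MS2021.IsEpsApprox.mul
    {f f' : MvPolynomial (Fin n) F} {g g' : MvPolynomial (Fin n) (RatFunc F)}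
    (h : MS2021.IsEpsApprox f g) (h' : MS2021.IsEpsApprox f' g') :
    MS2021.IsEpsApprox (f * f') (g * g') := by
  obtain ⟨G, rfl, rfl⟩ := isEpsApprox_iff_exists_map.mp h
  obtain ⟨G', rfl, rfl⟩ := isEpsApprox_iff_exists_map.mp h'
  exact isEpsApprox_iff_exists_map.mpr ⟨G * G', by rw [map_mul], by rw [map_mul]⟩

/-- `lim_{ε→0}` commutes with negation. [cite: DuttaDwivediSaxena2022, Def. 2.1 (full version p0016 L416–419)] -/
theorem _root_.Literature.Computability.AlgebraicComplexity.MS2021.IsEpsApprox.neg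
    {f : MvPolynomial (Fin n) F} {g : MvPolynomial (Fin n) (RatFunc F)}
    (h : MS2021.IsEpsApprox f g) : MS2021.IsEpsApprox (-f) (-g) := by
  obtain ⟨G, rfl, rfl⟩ := isEpsApprox_iff_exists_map.mp h
  exact isEpsApprox_iff_exists_map.mpr ⟨-G, by rw [map_neg], by rw [map_neg]⟩

/-- `lim_{ε→0}` commutes with subtraction. [cite: DuttaDwivediSaxena2022, Def. 2.1 (full version p0016 L416–419)] -/
theorem _root_.Literature.Computability.AlgebraicComplexity.MS2021.IsEpsApprox.sub
    {f f' : MvPolynomial (Fin n) F} {g g' : MvPolynomial (Fin n) (RatFunc F)}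
    (h : MS2021.IsEpsApprox f g) (h' : MS2021.IsEpsApprox f' g') :
    MS2021.IsEpsApprox (f - f') (g - g') := by
  rw [sub_eq_add_neg, sub_eq_add_neg]
  exact h.add h'.neg

/-- `lim_{ε→0}` commutes with powers. [cite: DuttaDwivediSaxena2022, Def. 2.1 (full version p0016 L416–419)] -/
theorem _root_.Literature.Computability.AlgebraicComplexity.MS2021.IsEpsApprox.pow
    {f : MvPolynomial (Fin n) F} {g : MvPolynomial (Fin n) (RatFunc F)}
    (h : MS2021.IsEpsApprox f g) (k : ℕ) : MS2021.IsEpsApprox (f ^ k) (g ^ k) := by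
  obtain ⟨G, rfl, rfl⟩ := isEpsApprox_iff_exists_map.mp h
  exact isEpsApprox_iff_exists_map.mpr ⟨G ^ k, by rw [map_pow], by rw [map_pow]⟩

/-- Constants of `F` approximate themselves. [cite: DuttaDwivediSaxena2022, Def. 2.1 (full version p0016 L416–419)] -/
theorem isEpsApprox_C (a : F) :
    MS2021.IsEpsApprox (C a : MvPolynomial (Fin n) F)
      (C (algebraMap F (RatFunc F) a) : MvPolynomial (Fin n) (RatFunc F)) :=
  isEpsApprox_iff_exists_map.mpr ⟨C (Polynomial.C a),
    by rw [map_C, ← algebraMap_comp_C, RingHom.comp_apply],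
    by rw [map_C, Polynomial.constantCoeff_apply, Polynomial.coeff_C_zero]⟩

/-- Variables approximate themselves. [cite: DuttaDwivediSaxena2022, Def. 2.1 (full version p0016 L416–419)] -/
theorem isEpsApprox_X (i : Fin n) :
    MS2021.IsEpsApprox (X i : MvPolynomial (Fin n) F) (X i : MvPolynomial (Fin n) (RatFunc F)) :=
  isEpsApprox_iff_exists_map.mpr ⟨X i, by rw [map_X], by rw [map_X]⟩

/-- The zero polynomial is approximated by zero. [cite: DuttaDwivediSaxena2022, Def. 2.1 (full version p0016 L416–419)] -/
theorem isEpsApprox_zero :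
    MS2021.IsEpsApprox (0 : MvPolynomial (Fin n) F) (0 : MvPolynomial (Fin n) (RatFunc F)) :=
  isEpsApprox_iff_exists_map.mpr ⟨0, by rw [map_zero], by rw [map_zero]⟩

/-- `lim_{ε→0}` commutes with finite sums. [cite: DuttaDwivediSaxena2022, Def. 2.1 (full version p0016 L416–419)] -/
theorem isEpsApprox_sum {ι : Type*} (s : Finset ι) {f : ι → MvPolynomial (Fin n) F}
    {g : ι → MvPolynomial (Fin n) (RatFunc F)} (h : ∀ i ∈ s, MS2021.IsEpsApprox (f i) (g i)) :
    MS2021.IsEpsApprox (∑ i ∈ s, f i) (∑ i ∈ s, g i) := by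
  classical
  induction s using Finset.induction_on with
  | empty =>
    rw [Finset.sum_empty, Finset.sum_empty]
    exact isEpsApprox_zero
  | insert a s ha ih =>
    rw [Finset.sum_insert ha, Finset.sum_insert ha]
    exact (h a (Finset.mem_insert_self a s)).add (ih fun i hi => h i (Finset.mem_insert_of_mem hi))

/-- `lim_{ε→0}` commutes with finite products. [cite: DuttaDwivediSaxena2022, Def. 2.1 (full version p0016 L416–419)] -/
theorem isEpsApprox_prod {ι : Type*} (s : Finset ι) {f : ι → MvPolynomial (Fin n) F}
    {g : ι → MvPolynomial (Fin n) (RatFunc F)} (h : ∀ i ∈ s, MS2021.IsEpsApprox (f i) (g i)) :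
    MS2021.IsEpsApprox (∏ i ∈ s, f i) (∏ i ∈ s, g i) := by
  classical
  induction s using Finset.induction_on with
  | empty =>
    rw [Finset.prod_empty, Finset.prod_empty]
    simpa using (isEpsApprox_C (n := n) (1 : F))
  | insert a s ha ih =>
    rw [Finset.prod_insert ha, Finset.prod_insert ha]
    exact (h a (Finset.mem_insert_self a s)).mul (ih fun i hi => h i (Finset.mem_insert_of_mem hi))

/-- **"`+ ε·Q`" does not change the limit**: adding `ε` times an integral polynomial to an
approximant of `f` gives an approximant of `f` (Def. 2.1, "`g(x,ε) := f(x) + ε·Q(x,ε)`").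
[cite: DuttaDwivediSaxena2022, Def. 2.1 (full version p0016 L416–419)] -/
theorem _root_.Literature.Computability.AlgebraicComplexity.MS2021.IsEpsApprox.add_eps_mul
    {f : MvPolynomial (Fin n) F} {g : MvPolynomial (Fin n) (RatFunc F)}
    (h : MS2021.IsEpsApprox f g) (S : MvPolynomial (Fin n) F[X]) :
    MS2021.IsEpsApprox f
      (g + C (algebraMap F[X] (RatFunc F) Polynomial.X) * map (algebraMap F[X] (RatFunc F)) S) := by
  obtain ⟨G, rfl, rfl⟩ := isEpsApprox_iff_exists_map.mp h
  refine isEpsApprox_iff_exists_map.mpr ⟨G + C Polynomial.X * S, by rw [map_add, map_mul, map_C], ?_⟩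
  rw [map_add, map_mul, map_C, Polynomial.constantCoeff_apply, Polynomial.coeff_X_zero, C_0, zero_mul,
    add_zero]

/-- `ε` times an integral polynomial approximates `0`. [cite: DuttaDwivediSaxena2022, Def. 2.1 (full version p0016 L416–419)] -/
theorem isEpsApprox_zero_eps_mul (S : MvPolynomial (Fin n) F[X]) :
    MS2021.IsEpsApprox (0 : MvPolynomial (Fin n) F)
      (C (algebraMap F[X] (RatFunc F) Polynomial.X) * map (algebraMap F[X] (RatFunc F)) S) := by
  simpa using (isEpsApprox_zero (n := n) (F := F)).add_eps_mul S

/-- `lim_{ε→0}` commutes with re-indexing of the variables. [cite: DuttaDwivediSaxena2022, Def. 2.1 (full version p0016 L416–419)] -/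
theorem _root_.Literature.Computability.AlgebraicComplexity.MS2021.IsEpsApprox.rename
    {f : MvPolynomial (Fin n) F} {g : MvPolynomial (Fin n) (RatFunc F)}
    (h : MS2021.IsEpsApprox f g) (σ : Fin n → Fin m) :
    MS2021.IsEpsApprox (rename σ f) (rename σ g) := by
  obtain ⟨G, rfl, rfl⟩ := isEpsApprox_iff_exists_map.mp h
  exact isEpsApprox_iff_exists_map.mpr
    ⟨MvPolynomial.rename σ G, by rw [map_rename], by rw [map_rename]⟩

/-- **`lim_{ε→0}` commutes with substitution of approximated polynomials**: if `q_i` approximates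
`p_i` for every variable `x_i` and `g` approximates `f`, then `g(q_1,…,q_n)` approximates
`f(p_1,…,p_n)`. For substitutions defined over `F` (DDS's `Φ : x_i ↦ z·x_i + α_i`, "`α_i` random
elements in `F`") this is "`Φ(g₀) = Φ(f₀) + ε·Φ(S₀)`". [cite: DuttaDwivediSaxena2022, §3 "Φ homomorphism" (full version p0028 L751–757)] -/
theorem _root_.Literature.Computability.AlgebraicComplexity.MS2021.IsEpsApprox.bind₁
    {f : MvPolynomial (Fin n) F} {g : MvPolynomial (Fin n) (RatFunc F)}
    (h : MS2021.IsEpsApprox f g) {p : Fin n → MvPolynomial (Fin m) F}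
    {q : Fin n → MvPolynomial (Fin m) (RatFunc F)} (hpq : ∀ i, MS2021.IsEpsApprox (p i) (q i)) :
    MS2021.IsEpsApprox (bind₁ p f) (bind₁ q g) := by
  obtain ⟨G, rfl, rfl⟩ := isEpsApprox_iff_exists_map.mp h
  choose Q hQq hQp using fun i => isEpsApprox_iff_exists_map.mp (hpq i)
  refine isEpsApprox_iff_exists_map.mpr ⟨MvPolynomial.bind₁ Q G, ?_, ?_⟩
  · rw [map_bind₁]
    exact congrArg (fun q' => MvPolynomial.bind₁ q' _) (funext hQq)
  · rw [map_bind₁]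
    exact congrArg (fun p' => MvPolynomial.bind₁ p' _) (funext hQp)

/-- Substitutions defined over `F` (such as DDS's `Φ : x_i ↦ z·x_i + α_i` and `Φ⁻¹`) commute with
`lim_{ε→0}`: "`Φ(g₀) = Φ(f₀) + ε·Φ(S₀)`". [cite: DuttaDwivediSaxena2022, §3 "Φ homomorphism" (full version p0028 L751–757)] -/
theorem _root_.Literature.Computability.AlgebraicComplexity.MS2021.IsEpsApprox.bind₁_algebraMap
    {f : MvPolynomial (Fin n) F} {g : MvPolynomial (Fin n) (RatFunc F)}
    (h : MS2021.IsEpsApprox f g) (p : Fin n → MvPolynomial (Fin m) F) :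
    MS2021.IsEpsApprox (bind₁ p f) (bind₁ (fun i => map (algebraMap F (RatFunc F)) (p i)) g) :=
  h.bind₁ fun i => isEpsApprox_map_algebraMap (p i)

/-- **`lim_{ε→0}` commutes with partial derivatives** (the DERIVE step of DiDIL is taken
before or after the limit indifferently: "`∂_z(Φ(f₀)/t_{k,0}) = lim_{ε→0} g₁`").
[cite: DuttaDwivediSaxena2022, Claim 3.4 and eq. (3.1) (full version p0029 L766–785)] -/
theorem _root_.Literature.Computability.AlgebraicComplexity.MS2021.IsEpsApprox.pderiv
    {f : MvPolynomial (Fin n) F} {g : MvPolynomial (Fin n) (RatFunc F)}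
    (h : MS2021.IsEpsApprox f g) (i : Fin n) :
    MS2021.IsEpsApprox (pderiv i f) (pderiv i g) := by
  obtain ⟨G, rfl, rfl⟩ := isEpsApprox_iff_exists_map.mp h
  exact isEpsApprox_iff_exists_map.mpr
    ⟨MvPolynomial.pderiv i G, by rw [pderiv_map], by rw [pderiv_map]⟩

end ApproxCalculus

/-! ### The single-ratio case `\overline{𝒞/𝒞} ⊆ \overline{𝒞}/\overline{𝒞}` (Claim 3.8's limit step) -/

section Ratio

variable {F : Type*} [Field F] {n : ℕ}

/-- The border of the one-element class `{1}` is `{1}`. [folklore] -/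
private theorem eq_one_of_mem_border_one {f : MvPolynomial (Fin n) F}
    (hf : f ∈ border ({1} : Set (MvPolynomial (Fin n) (RatFunc F)))) : f = 1 := by
  obtain ⟨g, hg, hfg⟩ := hf
  rw [Set.mem_singleton_iff] at hg
  rw [hg] at hfg
  exact hfg.unique (by simpa using isEpsApprox_C (n := n) (1 : F))

/-- Normal-form representative of `1` for the class `{1}`. [folklore] -/
private theorem one_rep :
    ∃ (c : RatFunc F) (G : MvPolynomial (Fin n) F[X]),
      (1 : MvPolynomial (Fin n) (RatFunc F)) = C c * map (algebraMap F[X] (RatFunc F)) G ∧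
        map (Polynomial.constantCoeff : F[X] →+* F) G ∈
            border ({1} : Set (MvPolynomial (Fin n) (RatFunc F))) ∧
          ((1 : MvPolynomial (Fin n) (RatFunc F)) ≠ 0 →
            c ≠ 0 ∧ map (Polynomial.constantCoeff : F[X] →+* F) G ≠ 0) := by
  refine ⟨1, 1, by rw [C_1, map_one, one_mul], ?_, fun _ => ⟨one_ne_zero, by
    rw [map_one]; exact one_ne_zero⟩⟩
  apply map_constantCoeff_mem_border
  rw [map_one]
  exact Set.mem_singleton 1

/-- **`\overline{𝒞/𝒞} ⊆ \overline{𝒞}/\overline{𝒞}`** (Lemma 2.20 with `𝒟 = {1}`) for a class `𝒞` closed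
under nonzero `F(ε)`-scalars, cleared form: `g₁ · E = M · g₂` (`gᵢ ∈ 𝒞`, `g₂ ≠ 0`, `E(0) ≠ 0`)
implies `M(0) · Ĝ₂ = u · Ĝ₁ · E(0)` with `Ĝᵢ ∈ \overline{𝒞}`, `Ĝ₂ ≠ 0`. With `𝒞 = Σ∧Σ` this is the
limit step of Claim 3.8, "`lim_{ε→0}(Σ∧Σ/Σ∧Σ) ⊆ (\overline{Σ∧Σ}/\overline{Σ∧Σ}) ⊆ (ARO/ARO)`"
(`border_div_swsClass`). [cite: DuttaDwivediSaxena2022, Lemma 2.20 (full version p0023 L628–636); Claim 3.8 proof (p0036 L938–943)] -/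
theorem border_div {𝒞 : Set (MvPolynomial (Fin n) (RatFunc F))}
    (h𝒞 : ∀ c : RatFunc F, c ≠ 0 → ∀ g ∈ 𝒞, C c * g ∈ 𝒞)
    {g₁ g₂ : MvPolynomial (Fin n) (RatFunc F)} (hg₁ : g₁ ∈ 𝒞) (hg₂ : g₂ ∈ 𝒞) (hg₂0 : g₂ ≠ 0)
    {E M : MvPolynomial (Fin n) F[X]} (hE : map (Polynomial.constantCoeff : F[X] →+* F) E ≠ 0)
    (heq : g₁ * map (algebraMap F[X] (RatFunc F)) E = map (algebraMap F[X] (RatFunc F)) M * g₂) :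
    ∃ G₁ G₂ : MvPolynomial (Fin n) F, G₁ ∈ border 𝒞 ∧ G₂ ∈ border 𝒞 ∧ G₂ ≠ 0 ∧
      ∃ u : F, map (Polynomial.constantCoeff : F[X] →+* F) M * G₂ =
          C u * G₁ * map (Polynomial.constantCoeff : F[X] →+* F) E ∧
        (map (Polynomial.constantCoeff : F[X] →+* F) M ≠ 0 → u ≠ 0) := by
  have heq' : g₁ * 1 * map (algebraMap F[X] (RatFunc F)) E =
      map (algebraMap F[X] (RatFunc F)) M * (g₂ * 1) := by
    rw [mul_one, mul_one]
    exact heq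
  obtain ⟨G₁, G₂, H₁, H₂, hG₁, hG₂, hH₁, hH₂, hG₂0, -, u, hu, hu0⟩ :=
    border_mulDiv_of_reps (𝒟 := ({1} : Set (MvPolynomial (Fin n) (RatFunc F)))) hg₂0 one_ne_zero
      (exists_border_rep_of_C_mul_mem h𝒞 hg₁) (exists_border_rep_of_C_mul_mem h𝒞 hg₂)
      one_rep one_rep hE heq'
  rw [eq_one_of_mem_border_one hH₁, eq_one_of_mem_border_one hH₂, mul_one, mul_one] at hu
  exact ⟨G₁, G₂, hG₁, hG₂, hG₂0, u, hu, hu0⟩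

/-- `\overline{𝒞/𝒞} ⊆ \overline{𝒞}/\overline{𝒞}` with the printed target "`g₁/g₂ = f + ε·Q`",
`f = f₁/f₂`, `Q = S/D` (`D(0) ≠ 0`), cleared: `g₁ · f₂ D = (f₁ D + ε·S f₂) · g₂`; then
`f₁ · Ĝ₂ = u · Ĝ₁ · f₂`, `u ≠ 0` unless `f₁ = 0`. [cite: DuttaDwivediSaxena2022, Lemma 2.20 (full version p0023 L628–636); Claim 3.8 proof (p0036 L938–943)] -/
theorem border_div_ratio {𝒞 : Set (MvPolynomial (Fin n) (RatFunc F))}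
    (h𝒞 : ∀ c : RatFunc F, c ≠ 0 → ∀ g ∈ 𝒞, C c * g ∈ 𝒞)
    {g₁ g₂ : MvPolynomial (Fin n) (RatFunc F)} (hg₁ : g₁ ∈ 𝒞) (hg₂ : g₂ ∈ 𝒞) (hg₂0 : g₂ ≠ 0)
    {f₁ f₂ : MvPolynomial (Fin n) F} (hf₂ : f₂ ≠ 0) {S D : MvPolynomial (Fin n) F[X]}
    (hD : map (Polynomial.constantCoeff : F[X] →+* F) D ≠ 0)
    (happrox : g₁ * (map (algebraMap F (RatFunc F)) f₂ * map (algebraMap F[X] (RatFunc F)) D) =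
      (map (algebraMap F (RatFunc F)) f₁ * map (algebraMap F[X] (RatFunc F)) D +
          C (algebraMap F[X] (RatFunc F) Polynomial.X) *
            (map (algebraMap F[X] (RatFunc F)) S * map (algebraMap F (RatFunc F)) f₂)) * g₂) :
    ∃ G₁ G₂ : MvPolynomial (Fin n) F, G₁ ∈ border 𝒞 ∧ G₂ ∈ border 𝒞 ∧ G₂ ≠ 0 ∧
      ∃ u : F, f₁ * G₂ = C u * G₁ * f₂ ∧ (f₁ ≠ 0 → u ≠ 0) := by
  obtain ⟨hE, hM, hE0, hM0⟩ := ratio_instance (F := F) f₁ f₂ S D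
  rw [← hE, ← hM] at happrox
  have hE' : map (Polynomial.constantCoeff : F[X] →+* F) (map Polynomial.C f₂ * D) ≠ 0 := by
    rw [hE0]
    exact mul_ne_zero hf₂ hD
  obtain ⟨G₁, G₂, hG₁, hG₂, hG₂0, u, hu, hu0⟩ := border_div h𝒞 hg₁ hg₂ hg₂0 hE' happrox
  rw [hE0, hM0] at hu
  rw [hM0] at hu0
  refine ⟨G₁, G₂, hG₁, hG₂, hG₂0, u, ?_, fun hf₁ => hu0 (mul_ne_zero hf₁ hD)⟩
  apply mul_right_cancel₀ hD
  linear_combination hu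

/-- **Claim 3.8, the limit step, PROVED**: "`lim_{ε→0}(Σ∧Σ/Σ∧Σ) ⊆ (\overline{Σ∧Σ}/\overline{Σ∧Σ})`"
("Also, we used that `Σ∧Σ` is closed under constant-fold multiplication … Finally, we take the
limit to conclude that `\overline{Σ∧Σ/Σ∧Σ} ⊆ ARO/ARO`"; the ARO/ABP reading of `\overline{Σ∧Σ}` is
Lemma 2.23, `DDS21DeborderReadOnce.lean`): cleared form `P · E = M · Q` with `P, Q ∈ Σ∧Σ` over
`F(ε)`, `Q ≠ 0`, `E(0) ≠ 0` ⟹ `M(0) · Q₀ = u · P₀ · E(0)`, `P₀, Q₀ ∈ \overline{Σ∧Σ}`, `Q₀ ≠ 0`.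
[cite: DuttaDwivediSaxena2022, Claim 3.8 with proof (full version p0036 L934–943)] -/
theorem border_div_swsClass {t e : ℕ} {P Q : MvPolynomial (Fin n) (RatFunc F)}
    (hP : P ∈ swsClass (RatFunc F) n t e) (hQ : Q ∈ swsClass (RatFunc F) n t e) (hQ0 : Q ≠ 0)
    {E M : MvPolynomial (Fin n) F[X]} (hE : map (Polynomial.constantCoeff : F[X] →+* F) E ≠ 0)
    (heq : P * map (algebraMap F[X] (RatFunc F)) E = map (algebraMap F[X] (RatFunc F)) M * Q) :
    ∃ P₀ Q₀ : MvPolynomial (Fin n) F,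
      P₀ ∈ border (swsClass (RatFunc F) n t e) ∧ Q₀ ∈ border (swsClass (RatFunc F) n t e) ∧
      Q₀ ≠ 0 ∧
      ∃ u : F, map (Polynomial.constantCoeff : F[X] →+* F) M * Q₀ =
          C u * P₀ * map (Polynomial.constantCoeff : F[X] →+* F) E ∧
        (map (Polynomial.constantCoeff : F[X] →+* F) M ≠ 0 → u ≠ 0) :=
  border_div (fun c _ _ hg => C_mul_mem_swsClass c hg) hP hQ hQ0 hE heq

end Ratio

end DDS2021

end Literature.Computability.AlgebraicComplexity

end
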